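import Literature.MathematicalPhysics.QuantumFieldTheory.Balaban1983to89.Node00.CritCfgAxialOfRecord
import Literature.MathematicalPhysics.QuantumFieldTheory.Balaban1983to89.Node00.TransportOfRecordGaugeFixing

/-!
# NODE 00 — [Ax-2] of WORK ORDER RC-1 «RE-CENTRE THE RECORD» (director-ym №462 (B)∕№463; CRIT-1 g33 RULING Q-3 (iii)): the (2.3) critical configuration
# and the (2.9) fluctuation cut-off of record RE-CENTRED AT PRINT'S BLOCK-AXIAL REPRESENTATIVE — `critCfgAxOfRecord`, `fluctDevAxOfRecord`,
# `chiFix29AxOfRecord`, `chiFixed29Ax` — one-token variants of `Node00/SmallFieldChi29OfRecord` :77∕:117∕:151∕:304 (append-only NEW names; no body of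
# record touched, body-freeze №460 (2)), with the receipts: choice-freeness on the [B11] domain, `AxialGauge`, `G = 0` ((2.5)'s premise at the record's own
# `gfOfRecord`), block-lift covariance, «= critCfg when the choice is already axial», N09's (M1) ON THE DOMAIN hypothesis-free, measurability

CITATION HEADER.  [I] = [Balaban1987RG1] (CMP **109**; held `paper:balaban1987-cmp109-rg-i-small-field`, journal page = PDF page + 248), p. 265 L19–27 verbatim:
*"there exists the exactly one critical point, which is obtained by taking the critical orbit of the function A(U_k(V)) considered on the subspace, and choosing
the element of the orbit satisfying the axial gauge conditions G(V) = 0. This critical configuration, which is a minimum of the function (2.2), is denoted by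
V^{(k)} = V^{(k)}(W), and is related to the minimal configuration U_{k+1}(W) in the axial gauge by the equality V^{(k)} = Ū^k_{k+1} = M^k(U_{k+1}). (2.3)"*;
p. 266 (2.5) *"The gauge fixing term under the exponential in (2.1) is equal to G(VV^{(k)}) = G(V′)"*; (2.9) p. 266 *"χ_k = Π_{b∈T^{(k)}∖{b₀(c)}} χ({|B′(b)| < ε₁})"*,
`V = exp(iB′)V^{(k)}`; (2.16) p. 269.  [B11] = [Balaban1985Variational] (CMP 102) Thm 1 p. 279, (181) p. 307.

WHY.  Cell `ym-nodeO-ideate` ∕ `ym-balaban-port` located reading «CHOICE CHANNEL» (porter PT-A-2, memo `CHOICE-CHANNEL-27930-v1.md` 411e97922ce21e6b;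
UPHELD by the critic of record, CRIT-1 g33 Q-3, 2026-08-30T23:39Z; adopted director-ym №462): the record's `critCfgOfRecord = Ū^k(Uk …)` is the k-fold
average of the BARE `Classical.choose` minimiser, no gauge normalisation, so the (2.9) cut-off centred at it — and through `chiβOfRecord₁₃` every VALUE of
`A_{k+1}`, `recordΦf`, `betaOfRecord₁₃` — depends on the choice (the gauge fixing `gfOfRecord` being absolute); print centres χ_k at THE block-axial
representative «G(V) = 0».  THIS FILE is the one-token re-centring (hands: PT-A-2 per №463; custodians: node00 def-Y∕def-T∕K0e; CRIT-1 (iii) spellings):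
* §1 `critCfgAxOfRecord ν K k W := axialize (contourOfRecord F N K k) (critCfgOfRecord F N ν K k W)` — axialised AFTER averaging w.r.t. the SAME contour datum
  `gfOfRecord` reads (CRIT-1 (iii) ∕ PT-A-2 (b)); receipts `critCfgAxOfRecord_eq_of_isBackground` ∕ `_eq_of_orbitRel` (CHOICE-FREE on `UkExists ∧ UniqueUkOrbit`),
  `axialGauge_critCfgAxOfRecord`, `gaugeFixFn_critCfgAx_eq_zero` ∕ `gfOfRecord_critCfgAx_eq_zero` (print's «G(V^{(k)}) = 0»), `critCfgAxOfRecord_gaugeAct`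
  (block-lift covariance = [B11] (181), a THEOREM), `critCfgAxOfRecord_eq_critCfgOfRecord_of_axialGauge` (nothing moves where the choice was already axial),
  `avg_critCfgAxOfRecord` (still in the fibre), `measurable_critCfgAxOfRecord_of`.
* §2 `fluctDevAxOfRecord` ∕ `chiFix29AxOfRecord` ∕ `chiFix29AllAxOfRecord` — bodies of :117∕:151∕:157 with `critCfgOfRecord ↦ critCfgAxOfRecord`; faces
  `_apply ∕ _nonneg ∕ _eq_zero_or_one ∕ _eq_one_iff`; ★ `fluctDevAxOfRecord_gaugeAct_liftTransf` ∕ `chiFix29AxOfRecord_gaugeAct_liftTransf` — N09's (M1) for the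
  re-centred cut-off ON THE [B11] DOMAIN, HYPOTHESIS-FREE (for the bare-choice cut-off it is the hypothesis `hcov` of `Summits/…/BalabanUVNodesN09LiftInvariance29AtRecord`).
* §3 `chiFixed29Ax ν ε₁ : (K : ℕ) → (ℕ → ℝ) → (k : ℕ) → Density …` — the β-slot re-keying (:304's twin), `chiFixed29Ax_flowBlind` ∕ `_apply` (`rfl`).
HONEST FRAMING.  Definitions (one-token variants) + bookkeeping; the [B11] hypotheses `UkExists`∕`UniqueUkOrbit` are never asserted; nothing of Bałaban's
estimates; NO existing body edited; `[Ax-3]` (`Record13Ax`: `chiβOfRecord₁₃Ax`, `betaOfRecord₁₃Ax`) and `[Ax-4]` (DEF-1 ed. 9 `recordΦfAx`) read these names;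
K0⁷∕K1⁹∕K3⁸ AS VETTED still read the choice-centred cut-off (restate pending the director); no `sorry`∕`instance`∕`notation`; standard axioms; the YM mass gap
(Clay) is NOT proved by any of this.
-/

noncomputable section

open MeasureTheory Set

namespace Literature.MathematicalPhysics.QuantumFieldTheory.Balaban1983to89.Node00

open T4Continuum (T4Family)
open T4TiltOscillation (bdev)
open B12GaugeOrbits021 (OrbitRel)
open B12RTGaugeInvariance254 (liftTransf avg_gaugeAct_liftTransf)
open BlockAxialRepresentative (axialize axialize_eq_self_of_axialGauge axialGauge_axialize gaugeFixFn_axialize)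
open GaugeField (gaugeAct)

variable (F : T4Family) (N : ℕ) [NeZero N]

/-! ## §1. (2.3) re-centred: the BLOCK-AXIAL critical configuration of record -/

/-- **`V^{(k)}_{ax}(W)` — THE BLOCK-AXIAL CRITICAL CONFIGURATION OF RECORD** ([I] p. 265: *«choosing the element of the orbit satisfying the axial gauge
conditions G(V) = 0 … V^{(k)} = M^k(U_{k+1}) (2.3)»*): the k-fold average of the minimiser of record, AXIALISED with respect to the contour datum of record
(`contourOfRecord`, the one `gfOfRecord` reads).  One-token variant of `critCfgOfRecord` (:77); on the [B11] domain it no longer depends on the chosen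
minimiser (`critCfgAxOfRecord_eq_of_isBackground`). [cite: Balaban1987RG1, (2.2)–(2.3) p.265] -/
def critCfgAxOfRecord (ν : Stage7Numerics) (K k : ℕ) (W : GaugeField (F.P K) (k + 1) (SU N)) : GaugeField (F.P K) k (SU N) :=
  axialize (contourOfRecord F N K k) (critCfgOfRecord F N ν K k W)

variable {F N}

/-- Unfolding (`rfl`). [cite: Balaban1987RG1, (2.3) p.265 (bookkeeping)] -/
theorem critCfgAxOfRecord_def (ν : Stage7Numerics) (K k : ℕ) (W : GaugeField (F.P K) (k + 1) (SU N)) :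
    critCfgAxOfRecord F N ν K k W = axialize (contourOfRecord F N K k) (critCfgOfRecord F N ν K k W) := rfl

/-- **CHOICE-FREENESS** — on the [B11] domain (one minimal orbit at `W`), `V^{(k)}_{ax}(W)` is the axialised k-fold average of ANY minimiser `U₀` over `W`
(print: «the exactly one critical point»). [cite: Balaban1987RG1, (2.2)–(2.3) p.265; Balaban1985Variational, Thm 1 p.279] -/
theorem critCfgAxOfRecord_eq_of_isBackground {ν : Stage7Numerics} {K k : ℕ} (hk : k ≤ (F.P K).m + (F.P K).K) {W : GaugeField (F.P K) (k + 1) (SU N)}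
    (huniq : UniqueUkOrbit F N K (k + 1) ν.εreg W) {U₀ : GaugeField (F.P K) 0 (SU N)}
    (hU₀ : IsBackground (avOfRecord F N K) (bgReg F N K (k + 1) ν.εreg) (k + 1) W U₀) :
    critCfgAxOfRecord F N ν K k W = axialize (contourOfRecord F N K k) (Averaging.iter (avOfRecord F N K) k U₀) := by
  rw [critCfgAxOfRecord_def]
  exact axialize_critCfgOfRecord_eq_of_isBackground hk _ huniq hU₀

/-- The same keyed by the orbit relation: any fine field in the residual orbit (level `k + 1`) of the chosen minimiser has the same axialised k-average.
[cite: Balaban1987RG1, (2.3) p.265, (0.21) p.256] -/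
theorem critCfgAxOfRecord_eq_of_orbitRel {ν : Stage7Numerics} {K k : ℕ} (hk : k ≤ (F.P K).m + (F.P K).K) {W : GaugeField (F.P K) (k + 1) (SU N)}
    {U₀' : GaugeField (F.P K) 0 (SU N)} (h : OrbitRel (k + 1) (Uk F N K (k + 1) ν.εreg W) U₀') :
    critCfgAxOfRecord F N ν K k W = axialize (contourOfRecord F N K k) (Averaging.iter (avOfRecord F N K) k U₀') := by
  rw [critCfgAxOfRecord_def, critCfgOfRecord_def]
  exact (axialize_iter_eq_of_orbitRel hk _ h).symm

/-- `V^{(k)}_{ax}(W)` satisfies the block axial gauge of record (`Setup.AxialGauge (contourOfRecord …)`). [cite: Balaban1987RG1, p.265 («the axial gauge conditions»)] -/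
theorem axialGauge_critCfgAxOfRecord {ν : Stage7Numerics} {K k : ℕ} (hk : k + 1 ≤ (F.P K).m + (F.P K).K) (W : GaugeField (F.P K) (k + 1) (SU N)) :
    AxialGauge (contourOfRecord F N K k) (critCfgAxOfRecord F N ν K k W) := by
  rw [critCfgAxOfRecord_def]
  exact axialGauge_axialize hk _ _

/-- **`G(Y, V^{(k)}_{ax}(W)) = 0`** for every block family `Y` — print's normalisation of (2.3). [cite: Balaban1987RG1, p.265 L21–23] -/
theorem gaugeFixFn_critCfgAx_eq_zero {ν : Stage7Numerics} {K k : ℕ} (hk : k + 1 ≤ (F.P K).m + (F.P K).K) (W : GaugeField (F.P K) (k + 1) (SU N))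
    (Y : Finset (Site (F.P K) (k + 1))) : gaugeFixFn (contourOfRecord F N K k) Y (critCfgAxOfRecord F N ν K k W) = 0 := by
  rw [critCfgAxOfRecord_def]
  exact gaugeFixFn_axialize hk _ _ Y

/-- **THE RECORD'S OWN GAUGE-FIXING TERM VANISHES AT `V^{(k)}_{ax}(W)`**: `gfOfRecord F N K k (V^{(k)}_{ax}(W)) = 0` — the premise of (2.5)
«G(VV^{(k)}) = G(V′)» at the record. [cite: Balaban1987RG1, (2.5) p.266, (0.17) p.255] -/
theorem gfOfRecord_critCfgAx_eq_zero {ν : Stage7Numerics} {K k : ℕ} (hk : k + 1 ≤ (F.P K).m + (F.P K).K) (W : GaugeField (F.P K) (k + 1) (SU N)) :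
    gfOfRecord F N K k (critCfgAxOfRecord F N ν K k W) = 0 := by
  unfold gfOfRecord
  exact gaugeFixFn_critCfgAx_eq_zero hk W _

/-- **BLOCK-LIFT COVARIANCE ON THE [B11] DOMAIN** — `V^{(k)}_{ax}(W^v) = (V^{(k)}_{ax}(W))^{v∘blockOf}` for `W` solvable at `W` with one minimal orbit at
`W^v` ([B11] (181) «U_k(V^v) = U_k(V)^{v̄}» for the axialised selection, as a theorem). [cite: Balaban1987RG1, (2.3) p.265, (2.16) p.269; Balaban1985Variational, (181) p.307] -/
theorem critCfgAxOfRecord_gaugeAct {ν : Stage7Numerics} {K k : ℕ} (hk : k + 1 ≤ (F.P K).m + (F.P K).K) (v : GaugeTransf (F.P K) (k + 1) (SU N))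
    {W : GaugeField (F.P K) (k + 1) (SU N)} (hex : UkExists F N K (k + 1) ν.εreg W) (huniq : UniqueUkOrbit F N K (k + 1) ν.εreg (gaugeAct v W)) :
    critCfgAxOfRecord F N ν K k (gaugeAct v W) = gaugeAct (liftTransf v) (critCfgAxOfRecord F N ν K k W) := by
  rw [critCfgAxOfRecord_def, critCfgAxOfRecord_def]
  exact axialize_critCfgOfRecord_gaugeAct hk _ v hex huniq

/-- **Nothing moves where the choice was already axial**: if the bare-choice `V^{(k)}(W)` happens to satisfy the block axial gauge, `V^{(k)}_{ax}(W) = V^{(k)}(W)`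
(director-ym №462 (B) receipt). [cite: Balaban1987RG1, p.265 (2.3) (bookkeeping)] -/
theorem critCfgAxOfRecord_eq_critCfgOfRecord_of_axialGauge {ν : Stage7Numerics} {K k : ℕ} (hk : k + 1 ≤ (F.P K).m + (F.P K).K)
    {W : GaugeField (F.P K) (k + 1) (SU N)} (h : AxialGauge (contourOfRecord F N K k) (critCfgOfRecord F N ν K k W)) :
    critCfgAxOfRecord F N ν K k W = critCfgOfRecord F N ν K k W := by
  rw [critCfgAxOfRecord_def]
  exact axialize_eq_self_of_axialGauge hk _ h

/-- **`V^{(k)}_{ax}(W)` STILL LIES IN THE FIBRE OVER `W`** on the solvable set: `M(V^{(k)}_{ax}(W)) = W` (the axialiser is `1` at the block centres, so by the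
averaging covariance `M(V^{a}) = (M V)^{a∘emb} = M V`). [cite: Balaban1987RG1, (2.3)–(2.4) pp.265–266] -/
theorem avg_critCfgAxOfRecord {ν : Stage7Numerics} {K k : ℕ} (hk : k + 1 ≤ (F.P K).m + (F.P K).K) {W : GaugeField (F.P K) (k + 1) (SU N)}
    (h : UkExists F N K (k + 1) ν.εreg W) : (avOfRecord F N K k).avg (critCfgAxOfRecord F N ν K k W) = W := by
  rw [critCfgAxOfRecord_def, BlockAxialRepresentative.axialize_def, (avOfRecord F N K k).covariant hk]
  have ha : (fun y => BlockAxialRepresentative.axializer (contourOfRecord F N K k) (critCfgOfRecord F N ν K k W) (emb y)) = fun _ => (1 : SU N) :=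
    funext fun y => BlockAxialRepresentative.axializer_emb hk _ _ y
  rw [ha, avg_critCfgOfRecord h]
  funext b
  simp only [GaugeField.gaugeAct, one_mul, inv_one, mul_one]

/-- `W ↦ V^{(k)}_{ax}(W)` is measurable AS SOON AS `W ↦ U_{k+1}(W)` is (averaging, the contours of record `measurable_holTo_contourOfRecord`, and
`BlockAxialRepresentative.measurable_axialize`); with `UkSel` in the χ-slot the hypothesis is `measurable_UkSel`. [cite: Balaban1987RG1, (2.3) p.265 (bookkeeping)] -/
theorem measurable_critCfgAxOfRecord_of {ν : Stage7Numerics} {K k : ℕ} (hU : Measurable (Uk F N K (k + 1) ν.εreg)) :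
    Measurable (critCfgAxOfRecord F N ν K k) :=
  (BlockAxialRepresentative.measurable_axialize _ (measurable_holTo_contourOfRecord F N K k)).comp (measurable_critCfgOfRecord_of hU)

variable (F N)

/-! ## §2. (2.9) re-centred: the fluctuation deviation and the cut-offs around `V^{(k)}_{ax}` -/

/-- **The fluctuation deviation CENTRED AT THE AXIAL REPRESENTATIVE**: `|V^{(k)}_{ax}(V̄)(b)⁻¹ · V(b) − 1|` — :117's twin. [cite: Balaban1987RG1, (2.1) p.265 and (2.9) p.266] -/
def fluctDevAxOfRecord (ν : Stage7Numerics) (K k : ℕ) (V : GaugeField (F.P K) k (SU N)) (b : PBond (F.P K) k) : ℝ :=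
  dist1 (bdev V (critCfgAxOfRecord F N ν K k ((avOfRecord F N K k).avg V)) b)

open Classical in
/-- **`χ^{(2.9)}_{k,ax}` OF RECORD — (2.9) AS PRINTED, CENTRED AT `V^{(k)}_{ax}`** (bonds `b₀(c)` excluded) — :151's twin. [cite: Balaban1987RG1, (2.9) p.266] -/
def chiFix29AxOfRecord (ν : Stage7Numerics) (ε₁ : ℝ) (K k : ℕ) : Density (F.P K) k (SU N) :=
  fun V => if ∀ b : PBond (F.P K) k, ¬ IsB0 b → fluctDevAxOfRecord F N ν K k V b < ε₁ then 1 else 0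

open Classical in
/-- The all-bonds twin centred at `V^{(k)}_{ax}` — :157's twin. [cite: Balaban1987RG1, (2.9) p.266] -/
def chiFix29AllAxOfRecord (ν : Stage7Numerics) (ε₁ : ℝ) (K k : ℕ) : Density (F.P K) k (SU N) :=
  fun V => if ∀ b : PBond (F.P K) k, fluctDevAxOfRecord F N ν K k V b < ε₁ then 1 else 0

variable {F N}

/-- Unfolding: `fluctDevAx … V b = dist1 (V^{(k)}_{ax}(V̄)(b)⁻¹ * V b)` (`rfl`). [cite: Balaban1987RG1, (2.9) p.266 (bookkeeping)] -/
theorem fluctDevAxOfRecord_apply (ν : Stage7Numerics) (K k : ℕ) (V : GaugeField (F.P K) k (SU N)) (b : PBond (F.P K) k) :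
    fluctDevAxOfRecord F N ν K k V b = dist1 ((critCfgAxOfRecord F N ν K k ((avOfRecord F N K k).avg V) b)⁻¹ * V b) := rfl

/-- `0 ≤ |V′(b) − 1|`. [cite: Balaban1987RG1, (2.9) p.266 (bookkeeping)] -/
theorem fluctDevAxOfRecord_nonneg (ν : Stage7Numerics) (K k : ℕ) (V : GaugeField (F.P K) k (SU N)) (b : PBond (F.P K) k) :
    0 ≤ fluctDevAxOfRecord F N ν K k V b :=
  GaugeGroup.dist1_nonneg _

/-- `χ^{(2.9)}_{ax} ∈ {0, 1}`. [cite: Balaban1987RG1, (2.9) p.266 (bookkeeping)] -/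
theorem chiFix29AxOfRecord_eq_zero_or_one (ν : Stage7Numerics) (ε₁ : ℝ) (K k : ℕ) (V : GaugeField (F.P K) k (SU N)) :
    chiFix29AxOfRecord F N ν ε₁ K k V = 0 ∨ chiFix29AxOfRecord F N ν ε₁ K k V = 1 := by
  unfold chiFix29AxOfRecord
  split_ifs
  · exact Or.inr rfl
  · exact Or.inl rfl

/-- **`χ^{(2.9)}_{k,ax}(V) = 1` iff every non-distinguished axial-centred fluctuation variable is `ε₁`-small.** [cite: Balaban1987RG1, (2.9) p.266] -/
theorem chiFix29AxOfRecord_eq_one_iff (ν : Stage7Numerics) (ε₁ : ℝ) (K k : ℕ) (V : GaugeField (F.P K) k (SU N)) :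
    chiFix29AxOfRecord F N ν ε₁ K k V = 1 ↔ ∀ b : PBond (F.P K) k, ¬ IsB0 b → fluctDevAxOfRecord F N ν K k V b < ε₁ := by
  unfold chiFix29AxOfRecord
  split_ifs with h
  · exact ⟨fun _ => h, fun _ => rfl⟩
  · exact ⟨fun h0 => absurd h0 zero_ne_one, fun h' => absurd h' h⟩

/-- `χ^{(2.9),all}_{ax}(V) = 1` iff every axial-centred fluctuation variable is `ε₁`-small. [cite: Balaban1987RG1, (2.9) p.266] -/
theorem chiFix29AllAxOfRecord_eq_one_iff (ν : Stage7Numerics) (ε₁ : ℝ) (K k : ℕ) (V : GaugeField (F.P K) k (SU N)) :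
    chiFix29AllAxOfRecord F N ν ε₁ K k V = 1 ↔ ∀ b : PBond (F.P K) k, fluctDevAxOfRecord F N ν K k V b < ε₁ := by
  unfold chiFix29AllAxOfRecord
  split_ifs with h
  · exact ⟨fun _ => h, fun _ => rfl⟩
  · exact ⟨fun h0 => absurd h0 zero_ne_one, fun h' => absurd h' h⟩

/-- **★ THE AXIAL-CENTRED FLUCTUATION DEVIATION IS LIFT-INVARIANT ON THE [B11] DOMAIN** — `fluctDevAx(V^{v∘blockOf}) b = fluctDevAx(V) b` whenever `V̄` is
solvable with one minimal orbit at `V̄^v` ([I] p. 265 «the expressions in (2.1) are invariant»); NO covariance hypothesis (contrast the bare-choice cut-off).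
[cite: Balaban1987RG1, (2.1) p.265, (2.9) p.266, (2.16) p.269] -/
theorem fluctDevAxOfRecord_gaugeAct_liftTransf {ν : Stage7Numerics} {K k : ℕ} (hk : k + 1 ≤ (F.P K).m + (F.P K).K)
    (v : GaugeTransf (F.P K) (k + 1) (SU N)) (V : GaugeField (F.P K) k (SU N)) (hex : UkExists F N K (k + 1) ν.εreg ((avOfRecord F N K k).avg V))
    (huniq : UniqueUkOrbit F N K (k + 1) ν.εreg (gaugeAct v ((avOfRecord F N K k).avg V))) (b : PBond (F.P K) k) :
    fluctDevAxOfRecord F N ν K k (gaugeAct (liftTransf v) V) b = fluctDevAxOfRecord F N ν K k V b := by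
  rw [fluctDevAxOfRecord_apply, fluctDevAxOfRecord_apply, critCfgAxOfRecord_def, critCfgAxOfRecord_def]
  exact dist1_axialCentre_gaugeAct_liftTransf hk _ v V hex huniq b

/-- **★ N09's (M1) FOR THE RE-CENTRED CUT-OFF, ON THE [B11] DOMAIN, HYPOTHESIS-FREE**: `χ^{(2.9)}_{k,ax}(V^{v∘blockOf}) = χ^{(2.9)}_{k,ax}(V)`.
[cite: Balaban1987RG1, (2.9) p.266 and (2.16) p.269] -/
theorem chiFix29AxOfRecord_gaugeAct_liftTransf {ν : Stage7Numerics} (ε₁ : ℝ) {K k : ℕ} (hk : k + 1 ≤ (F.P K).m + (F.P K).K)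
    (v : GaugeTransf (F.P K) (k + 1) (SU N)) (V : GaugeField (F.P K) k (SU N)) (hex : UkExists F N K (k + 1) ν.εreg ((avOfRecord F N K k).avg V))
    (huniq : UniqueUkOrbit F N K (k + 1) ν.εreg (gaugeAct v ((avOfRecord F N K k).avg V))) :
    chiFix29AxOfRecord F N ν ε₁ K k (gaugeAct (liftTransf v) V) = chiFix29AxOfRecord F N ν ε₁ K k V := by
  have key : (∀ b : PBond (F.P K) k, ¬ IsB0 b → fluctDevAxOfRecord F N ν K k (gaugeAct (liftTransf v) V) b < ε₁) ↔
      ∀ b : PBond (F.P K) k, ¬ IsB0 b → fluctDevAxOfRecord F N ν K k V b < ε₁ := by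
    simp only [fluctDevAxOfRecord_gaugeAct_liftTransf hk v V hex huniq]
  unfold chiFix29AxOfRecord
  by_cases hQ : ∀ b : PBond (F.P K) k, ¬ IsB0 b → fluctDevAxOfRecord F N ν K k V b < ε₁
  · rw [if_pos hQ, if_pos (key.2 hQ)]
  · rw [if_neg hQ, if_neg fun h => hQ (key.1 h)]

/-- The all-bonds twin of (M1) on the domain. [cite: Balaban1987RG1, (2.9) p.266] -/
theorem chiFix29AllAxOfRecord_gaugeAct_liftTransf {ν : Stage7Numerics} (ε₁ : ℝ) {K k : ℕ} (hk : k + 1 ≤ (F.P K).m + (F.P K).K)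
    (v : GaugeTransf (F.P K) (k + 1) (SU N)) (V : GaugeField (F.P K) k (SU N)) (hex : UkExists F N K (k + 1) ν.εreg ((avOfRecord F N K k).avg V))
    (huniq : UniqueUkOrbit F N K (k + 1) ν.εreg (gaugeAct v ((avOfRecord F N K k).avg V))) :
    chiFix29AllAxOfRecord F N ν ε₁ K k (gaugeAct (liftTransf v) V) = chiFix29AllAxOfRecord F N ν ε₁ K k V := by
  have key : (∀ b : PBond (F.P K) k, fluctDevAxOfRecord F N ν K k (gaugeAct (liftTransf v) V) b < ε₁) ↔
      ∀ b : PBond (F.P K) k, fluctDevAxOfRecord F N ν K k V b < ε₁ := by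
    simp only [fluctDevAxOfRecord_gaugeAct_liftTransf hk v V hex huniq]
  unfold chiFix29AllAxOfRecord
  by_cases hQ : ∀ b : PBond (F.P K) k, fluctDevAxOfRecord F N ν K k V b < ε₁
  · rw [if_pos hQ, if_pos (key.2 hQ)]
  · rw [if_neg hQ, if_neg fun h => hQ (key.1 h)]

variable (F N)

/-! ## §3. The β-slot re-keying, re-centred -/

/-- **THE (2.9)-KEYED β-SLOT χ, RE-CENTRED** `chiFixed29Ax ν ε₁ : (K : ℕ) → (ℕ → ℝ) → (k : ℕ) → Density (F.P K) k (SU N)` — :304's twin (coupling-blind); the χ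
that `[Ax-3]`'s `chiβOfRecord₁₃Ax` feeds to the β-layer. [cite: Balaban1987RG1, (0.19) p.256 and (2.9) p.266] -/
def chiFixed29Ax (ν : Stage7Numerics) (ε₁ : ℝ) : (K : ℕ) → (ℕ → ℝ) → (k : ℕ) → Density (F.P K) k (SU N) :=
  fun K _ k => chiFix29AxOfRecord F N ν ε₁ K k

variable {F N}

/-- Coupling-blind by typing (`rfl`). [cite: Balaban1987RG1, (2.9) p.266 (bookkeeping)] -/
theorem chiFixed29Ax_flowBlind (ν : Stage7Numerics) (ε₁ : ℝ) (K : ℕ) (g g' : ℕ → ℝ) : chiFixed29Ax F N ν ε₁ K g = chiFixed29Ax F N ν ε₁ K g' := rfl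

/-- Unfolding at a run (`rfl`). [cite: Balaban1987RG1, (2.9) p.266 (bookkeeping)] -/
theorem chiFixed29Ax_apply (ν : Stage7Numerics) (ε₁ : ℝ) (K : ℕ) (g : ℕ → ℝ) (k : ℕ) : chiFixed29Ax F N ν ε₁ K g k = chiFix29AxOfRecord F N ν ε₁ K k := rfl

/-- **★ (M1) AT THE β-SLOT, RE-CENTRED** (v2 append; porter PTZ-1's S5-0 (i) hinge «`chiFixed29Ax` lift-invariance»): the (2.9)-keyed re-centred slot
`chiFixed29Ax ν ε₁ K g k` — the χ that `chiβOfRecord₁₃Ax` feeds to the β-layer, for EVERY coupling history `g` — is invariant under the lifted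
transformation `v ∘ blockOf` on the [B11] domain (solvability at `V̄`, one minimal orbit at `V̄^v`); NO covariance hypothesis.
[cite: Balaban1987RG1, (2.9) p.266 and (2.16) p.269] -/
theorem chiFixed29Ax_gaugeAct_liftTransf {ν : Stage7Numerics} (ε₁ : ℝ) {K k : ℕ} (hk : k + 1 ≤ (F.P K).m + (F.P K).K) (g : ℕ → ℝ)
    (v : GaugeTransf (F.P K) (k + 1) (SU N)) (V : GaugeField (F.P K) k (SU N)) (hex : UkExists F N K (k + 1) ν.εreg ((avOfRecord F N K k).avg V))
    (huniq : UniqueUkOrbit F N K (k + 1) ν.εreg (gaugeAct v ((avOfRecord F N K k).avg V))) :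
    chiFixed29Ax F N ν ε₁ K g k (gaugeAct (liftTransf v) V) = chiFixed29Ax F N ν ε₁ K g k V := by
  rw [chiFixed29Ax_apply]
  exact chiFix29AxOfRecord_gaugeAct_liftTransf ε₁ hk v V hex huniq

/-- The re-centred β-slot takes only the values `0` and `1`. [cite: Balaban1987RG1, (2.9) p.266 (bookkeeping)] -/
theorem chiFixed29Ax_eq_zero_or_one (ν : Stage7Numerics) (ε₁ : ℝ) (K : ℕ) (g : ℕ → ℝ) (k : ℕ) (V : GaugeField (F.P K) k (SU N)) :
    chiFixed29Ax F N ν ε₁ K g k V = 0 ∨ chiFixed29Ax F N ν ε₁ K g k V = 1 := by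
  rw [chiFixed29Ax_apply]
  exact chiFix29AxOfRecord_eq_zero_or_one ν ε₁ K k V

end Literature.MathematicalPhysics.QuantumFieldTheory.Balaban1983to89.Node00

end
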